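import Mathlib
import Summits.Parity.BatemanHorn.Theorems.IsogenyRedeiTypeIMainTermRieszBound
import HarnessLib

/-!
# Type-I main term for Bateman–Horn (stmt-Parity-0873), input A2 (part 1):
# de-smoothing the log-Riesz means — `∑_{n ≤ x} μ(n) ρ_f(n)/n ≪ exp(−c√log x)`

For `f ∈ ℤ[X]` irreducible of positive degree:

* `shiu_short_interval_rootCount` — `∑_{x < n ≤ x+y} μ²(n)ρ_f(n) ≤ C y` for `x ≥ x₀`,
  `x^{1/4} ≤ y ≤ x` (Shiu's Brun–Titchmarsh theorem for multiplicative functions, the tree's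
  `Shiu1980BrunTitchmarsh_holds`, with `exp(∑_{p ≤ x} ρ_f(p)/p) ≪ log x` from
  `exists_sum_primesLE_rootCount_div_le`);
* `riesz_sub_riesz_eq` — the difference identity
  `ℛ(y) − ℛ(x) = (log y − log x) S(x) + ∑_{x < n ≤ y} a(n) log(y/n)`;
* `abs_sum_moebius_rootDensity_le` — **the sharp sums**: `|∑_{n ≤ x} μ(n)ρ_f(n)/n| ≤ C e^{−c√log x}`
  for all `x ≥ 1`, from `abs_logRieszMean_moebius_rootDensity_sub_le` at `x` and `x e^h`,
  `h = e^{−(c/2)√log x}`, the difference identity, and Shiu's bound for the short sum.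

Everything here is proved.
-/

noncomputable section

open Filter Finset Polynomial ArithmeticFunction Complex
open scoped ArithmeticFunction.Moebius ArithmeticFunction.omega Topology

namespace Summit.Parity.BatemanHorn.Theorems.TypeIMainTerm

open Literature.NumberTheory.Sieve Literature.NumberTheory.LFunctions

/-! ### Shiu's theorem for `μ²(n) ρ_f(n)` on short intervals -/

/-- **Short-interval mean value of `μ² ρ_f` (Shiu).** For `f` irreducible of positive degree there
are `C ≥ 0`, `x₀` with `∑_{x < n ≤ x + y} μ²(n) ρ_f(n) ≤ C y` whenever `x ≥ x₀` and
`x^{1/4} ≤ y ≤ x` (Shiu's Brun–Titchmarsh theorem for multiplicative functions, the tree's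
`Shiu1980BrunTitchmarsh_holds`, with `exp(∑_{p ≤ x} ρ_f(p)/p) ≪ log x`). -/
theorem shiu_short_interval_rootCount {f : ℤ[X]} (hirr : Irreducible f) (hdeg : 0 < f.natDegree) :
    ∃ C x₀ : ℝ, 0 ≤ C ∧ ∀ x y : ℝ, x₀ ≤ x → x ^ (1 / 4 : ℝ) ≤ y → y ≤ x →
      ∑ n ∈ (Finset.Icc 1 ⌊x + y⌋₊).filter (fun n : ℕ => x < n),
          (μ n : ℝ) ^ 2 * (polyRootCountMod ![f] n : ℝ) ≤ C * y := by
  classical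
  obtain ⟨B, hB1, hB⟩ := exists_rootCount_prime_le hirr.ne_zero
  have hB0 : 0 ≤ B := by linarith
  obtain ⟨Cf, hCf⟩ := exists_sum_primesLE_rootCount_div_le hirr hdeg
  set F : ℕ → ℝ := fun n => (μ n : ℝ) ^ 2 * (polyRootCountMod ![f] n : ℝ) with hF
  have hF0 : ∀ n, 0 ≤ F n := fun n => by positivity
  have hFmul : ∀ m n : ℕ, m.Coprime n → F (m * n) = F m * F n := by
    intro m n hmn
    simp only [hF]
    rw [ArithmeticFunction.isMultiplicative_moebius.map_mul_of_coprime hmn,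
      polyRootCountMod_mul_of_coprime f hmn]
    push_cast
    ring
  have hFpow : ∀ p l : ℕ, p.Prime → 1 ≤ l → F (p ^ l) ≤ B ^ l := by
    intro p l hp hl
    simp only [hF]
    rcases Nat.lt_or_ge l 2 with hl2 | hl2
    · have : l = 1 := by omega
      subst this
      rw [pow_one, pow_one, ArithmeticFunction.moebius_apply_prime hp]
      push_cast
      nlinarith [hB p hp]
    · rw [ArithmeticFunction.moebius_apply_prime_pow hp (by omega), if_neg (by omega)]
      simp only [Int.cast_zero, ne_eq, OfNat.ofNat_ne_zero, not_false_eq_true, zero_pow, zero_mul]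
      positivity
  have hFδ : ∀ δ : ℝ, 0 < δ → ∀ n : ℕ, 1 ≤ n →
      F n ≤ B ^ (⌊B ^ (1 / δ)⌋₊ + 1) * (n : ℝ) ^ δ := by
    intro δ hδ n hn
    simp only [hF]
    by_cases hsq : Squarefree n
    · have hμ : (μ n : ℝ) ^ 2 = 1 := by
        rw [ArithmeticFunction.moebius_apply_of_squarefree hsq]; push_cast
        rw [← pow_mul, mul_comm, pow_mul, neg_one_sq, one_pow]
      rw [hμ, one_mul]
      exact (rootCount_le_pow_of_squarefree f hB hsq).trans
        (pow_card_primeFactors_le hB1 hδ (by omega))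
    · rw [ArithmeticFunction.moebius_eq_zero_of_not_squarefree hsq]
      simp only [Int.cast_zero, ne_eq, OfNat.ofNat_ne_zero, not_false_eq_true, zero_pow, zero_mul]
      positivity
  obtain ⟨C, x₀, hmain⟩ := Shiu1980BrunTitchmarsh_holds F hF0 hFmul B hFpow
    (fun δ => B ^ (⌊B ^ (1 / δ)⌋₊ + 1)) hFδ (1 / 4) (1 / 4) (by norm_num) (by norm_num)
    (by norm_num) (by norm_num)
  refine ⟨max C 0 * Real.exp Cf, max x₀ 2, by positivity, fun x y hx hxy hyx => ?_⟩
  have hx2 : (2 : ℝ) ≤ x := le_trans (le_max_right _ _) hx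
  have hx0 : x₀ ≤ x := le_trans (le_max_left _ _) hx
  have hxpos : 0 < x := by linarith
  have hy1 : 1 < y := by
    refine lt_of_lt_of_le ?_ hxy
    exact Real.one_lt_rpow (by linarith) (by norm_num)
  have hq : ((1 : ℕ) : ℝ) < y ^ (1 - (1 / 4 : ℝ)) := by
    rw [Nat.cast_one]; exact Real.one_lt_rpow hy1 (by norm_num)
  have h := hmain x y hx0 hxy hyx 1 le_rfl hq 0 (Nat.coprime_one_right 0)
  -- the congruence condition modulo `1` is vacuous
  have hfilter : (Finset.Icc 1 ⌊x + y⌋₊).filter (fun n : ℕ => x < n ∧ (n : ZMod 1) = ((0 : ℕ) : ZMod 1))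
      = (Finset.Icc 1 ⌊x + y⌋₊).filter (fun n : ℕ => x < n) :=
    Finset.filter_congr fun n _ => ⟨fun h => h.1, fun h => ⟨h, Subsingleton.elim _ _⟩⟩
  rw [hfilter, Nat.totient_one, Nat.cast_one, one_mul] at h
  -- the Mertens-type factor
  have hprimes : (Finset.Icc 1 ⌊x⌋₊).filter (fun p : ℕ => p.Prime ∧ ¬p ∣ 1) = Nat.primesLE ⌊x⌋₊ := by
    ext p
    simp only [Finset.mem_filter, Finset.mem_Icc, Nat.mem_primesLE, Nat.dvd_one]
    constructor
    · rintro ⟨⟨-, h2⟩, h3, -⟩; exact ⟨h2, h3⟩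
    · rintro ⟨h1, h2⟩; exact ⟨⟨h2.one_lt.le, h1⟩, h2, h2.one_lt.ne'⟩
  have hx2' : 2 ≤ ⌊x⌋₊ := Nat.le_floor (by exact_mod_cast hx2)
  have hlogx : 0 < Real.log x := Real.log_pos (by linarith)
  have hexp : Real.exp (∑ p ∈ (Finset.Icc 1 ⌊x⌋₊).filter (fun p : ℕ => p.Prime ∧ ¬p ∣ 1), F p / p)
      ≤ Real.exp Cf * Real.log x := by
    rw [hprimes]
    have h1 : ∑ p ∈ Nat.primesLE ⌊x⌋₊, F p / p =
        ∑ p ∈ Nat.primesLE ⌊x⌋₊, (polyRootCountMod ![f] p : ℝ) / p := by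
      refine Finset.sum_congr rfl fun p hp => ?_
      have hp' := Nat.prime_of_mem_primesLE hp
      simp only [hF]
      rw [ArithmeticFunction.moebius_apply_prime hp']; push_cast; ring
    rw [h1]
    have h2 := hCf ⌊x⌋₊ hx2'
    have h3 : Real.log (Real.log (⌊x⌋₊ : ℝ)) ≤ Real.log (Real.log x) := by
      have hfl : (2 : ℝ) ≤ ⌊x⌋₊ := by exact_mod_cast hx2'
      refine Real.log_le_log (Real.log_pos (by linarith)) ?_
      exact Real.log_le_log (by linarith) (Nat.floor_le hxpos.le)
    calc Real.exp (∑ p ∈ Nat.primesLE ⌊x⌋₊, (polyRootCountMod ![f] p : ℝ) / p)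
        ≤ Real.exp (Real.log (Real.log x) + Cf) := Real.exp_le_exp.mpr (by linarith)
      _ = Real.exp Cf * Real.log x := by rw [Real.exp_add, Real.exp_log hlogx, mul_comm]
  have hC0 : C * y / Real.log x ≤ max C 0 * y / Real.log x :=
    div_le_div_of_nonneg_right (mul_le_mul_of_nonneg_right (le_max_left _ _) (by linarith))
      hlogx.le
  calc ∑ n ∈ (Finset.Icc 1 ⌊x + y⌋₊).filter (fun n : ℕ => x < n), F n
      ≤ C * y / Real.log x *
          Real.exp (∑ p ∈ (Finset.Icc 1 ⌊x⌋₊).filter (fun p : ℕ => p.Prime ∧ ¬p ∣ 1), F p / p) := h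
    _ ≤ max C 0 * y / Real.log x * (Real.exp Cf * Real.log x) :=
        mul_le_mul hC0 hexp (Real.exp_nonneg _) (by positivity)
    _ = max C 0 * Real.exp Cf * y := by field_simp

/-! ### De-smoothing: the sharp sums `∑_{n ≤ x} μ(n) ρ_f(n)/n` -/

/-- `|μ(n) ρ_f(n)/n| ≤ 1`. -/
theorem abs_moebius_mul_rootDensity_le_one (f : ℤ[X]) (n : ℕ) :
    |(μ n : ℝ) * rootDensity f n| ≤ 1 := by
  rw [abs_mul]
  have h1 : |(μ n : ℝ)| ≤ 1 := by exact_mod_cast ArithmeticFunction.abs_moebius_le_one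
  have h2 : |rootDensity f n| ≤ 1 := by
    rw [abs_of_nonneg (rootDensity_nonneg f n)]; exact rootDensity_le_one f n
  nlinarith [abs_nonneg (μ n : ℝ), abs_nonneg (rootDensity f n)]

/-- `|μ(n) ρ_f(n)/n| = μ(n)² ρ_f(n)/n`. -/
theorem abs_moebius_mul_rootDensity_eq (f : ℤ[X]) (n : ℕ) :
    |(μ n : ℝ) * rootDensity f n| = (μ n : ℝ) ^ 2 * (polyRootCountMod ![f] n : ℝ) / n := by
  rw [abs_mul, abs_of_nonneg (rootDensity_nonneg f n), rootDensity_apply, mul_div_assoc]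
  congr 1
  rcases ArithmeticFunction.moebius_eq_or n with h | h | h <;> simp [h]

/-- **Riesz difference identity**: for `1 ≤ x ≤ y`,
`ℛ(y) − ℛ(x) = (log y − log x) S(x) + ∑_{x < n ≤ y} a(n) log(y/n)` where
`S(x) = ∑_{n ≤ x} a(n)`, `ℛ(x) = ∑_{n ≤ x} a(n) log(x/n)`. -/
theorem riesz_sub_riesz_eq (a : ℕ → ℝ) {x y : ℝ} (hx : 1 ≤ x) (hxy : x ≤ y) :
    ∑ n ∈ Icc 1 ⌊y⌋₊, a n * Real.log (y / n) - ∑ n ∈ Icc 1 ⌊x⌋₊, a n * Real.log (x / n) =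
      (Real.log y - Real.log x) * ∑ n ∈ Icc 1 ⌊x⌋₊, a n +
        ∑ n ∈ Icc (⌊x⌋₊ + 1) ⌊y⌋₊, a n * Real.log (y / n) := by
  have hx0 : 0 < x := by linarith
  have hy0 : 0 < y := by linarith
  have hfl : ⌊x⌋₊ ≤ ⌊y⌋₊ := Nat.floor_le_floor hxy
  have hsplit : ∑ n ∈ Icc 1 ⌊y⌋₊, a n * Real.log (y / n) =
      ∑ n ∈ Icc 1 ⌊x⌋₊, a n * Real.log (y / n) + ∑ n ∈ Icc (⌊x⌋₊ + 1) ⌊y⌋₊, a n * Real.log (y / n) := by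
    rw [← Finset.Ico_add_one_right_eq_Icc, ← Finset.Ico_add_one_right_eq_Icc,
      ← Finset.Ico_add_one_right_eq_Icc, Finset.sum_Ico_consecutive _ (by omega) (by omega)]
  rw [hsplit, Finset.mul_sum, add_sub_right_comm, ← Finset.sum_sub_distrib]
  congr 1
  refine Finset.sum_congr rfl fun n hn => ?_
  have hn1 : (0 : ℝ) < n := by exact_mod_cast (Finset.mem_Icc.mp hn).1
  rw [Real.log_div hy0.ne' hn1.ne', Real.log_div hx0.ne' hn1.ne']
  ring

/-- **De-smoothing.** For `f ∈ ℤ[X]` irreducible of positive degree there are `c > 0`, `C` with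
`|∑_{n ≤ x} μ(n) ρ_f(n)/n| ≤ C exp(−c √log x)` for all `x ≥ 1`: from the log-Riesz means
(`abs_logRieszMean_moebius_rootDensity_sub_le`) at `x` and `x e^h`, `h = exp(−(c/2)√log x)`, the
difference identity `riesz_sub_riesz_eq`, and Shiu's bound `∑_{x < n ≤ xe^h} μ²(n)ρ_f(n) ≪ xh`
for the short sum (`shiu_short_interval_rootCount`). -/
theorem abs_sum_moebius_rootDensity_le {f : ℤ[X]} (hirr : Irreducible f) (hdeg : 1 ≤ f.natDegree) :
    ∃ c C : ℝ, 0 < c ∧ ∀ x : ℝ, 1 ≤ x →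
      |∑ n ∈ Icc 1 ⌊x⌋₊, (μ n : ℝ) * rootDensity f n| ≤
        C * Real.exp (-c * Real.sqrt (Real.log x)) := by
  obtain ⟨c₀, c, C_R, hc, hR⟩ := abs_logRieszMean_moebius_rootDensity_sub_le hirr hdeg
  obtain ⟨C_S, x₀, hCS, hShiu⟩ := shiu_short_interval_rootCount hirr hdeg
  set g : ℕ → ℝ := fun n => (μ n : ℝ) * rootDensity f n with hg
  have hC_R : 0 ≤ C_R := by
    have h := (abs_nonneg _).trans (hR 1 le_rfl)
    simpa using h
  -- thresholds
  set L₀ : ℝ := max (max ((2 * c / 3) ^ 2) ((2 * Real.log 2 / c) ^ 2)) 1 with hL₀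
  set x₁ : ℝ := max (max x₀ 2) (Real.exp L₀) with hx₁
  -- the estimate for large `x`
  have hlarge : ∀ x : ℝ, x₁ ≤ x →
      |∑ n ∈ Icc 1 ⌊x⌋₊, g n| ≤ (2 * C_R + 2 * C_S) * Real.exp (-(c / 2) * Real.sqrt (Real.log x)) := by
    intro x hx
    have hx2 : (2 : ℝ) ≤ x := le_trans (le_trans (le_max_right _ _) (le_max_left _ _)) hx
    have hxx₀ : x₀ ≤ x := le_trans (le_trans (le_max_left _ _) (le_max_left _ _)) hx
    have hx0 : 0 < x := by linarith
    have hx1 : 1 ≤ x := by linarith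
    set L : ℝ := Real.log x with hL
    have hLL₀ : L₀ ≤ L := by
      rw [hL, ← Real.log_exp L₀]
      exact Real.log_le_log (Real.exp_pos _) (le_trans (le_max_right _ _) hx)
    have hL1 : 1 ≤ L := le_trans (le_max_right _ _) hLL₀
    have hLpos : 0 < L := by linarith
    set u : ℝ := Real.sqrt L with hu
    have hu0 : 0 < u := Real.sqrt_pos.mpr hLpos
    have huL : u ^ 2 = L := Real.sq_sqrt hLpos.le
    have hu1 : 2 * c / 3 ≤ u := by
      rw [hu, ← Real.sqrt_sq (by positivity : (0 : ℝ) ≤ 2 * c / 3)]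
      exact Real.sqrt_le_sqrt (le_trans (le_trans (le_max_left _ _) (le_max_left _ _)) hLL₀)
    have hu2 : 2 * Real.log 2 / c ≤ u := by
      rw [hu, ← Real.sqrt_sq (by positivity : (0 : ℝ) ≤ 2 * Real.log 2 / c)]
      exact Real.sqrt_le_sqrt (le_trans (le_trans (le_max_right _ _) (le_max_left _ _)) hLL₀)
    set h : ℝ := Real.exp (-(c / 2) * u) with hh
    have hh0 : 0 < h := Real.exp_pos _
    have hhle : h ≤ 1 / 2 := by
      -- `(c/2) u ≥ log 2`
      have h1 : Real.log 2 ≤ (c / 2) * u := by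
        have := mul_le_mul_of_nonneg_left hu2 (by positivity : (0 : ℝ) ≤ c / 2)
        rwa [show c / 2 * (2 * Real.log 2 / c) = Real.log 2 by field_simp] at this
      rw [hh, show (1 : ℝ) / 2 = Real.exp (-Real.log 2) by
        rw [Real.exp_neg, Real.exp_log two_pos, one_div]]
      exact Real.exp_le_exp.mpr (by linarith)
    have hh1 : |h| ≤ 1 := by rw [abs_of_pos hh0]; linarith
    have hexp1 : Real.exp h - 1 ≤ 2 * h := by
      have := Real.abs_exp_sub_one_le hh1
      rw [abs_of_pos hh0] at this
      exact (le_abs_self _).trans this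
    have hexp2 : h ≤ Real.exp h - 1 := by linarith [Real.add_one_le_exp h]
    set y : ℝ := x * Real.exp h with hy
    have hyx : x ≤ y := by
      rw [hy]; nlinarith [Real.add_one_le_exp h, Real.exp_pos h]
    have hy1 : 1 ≤ y := le_trans hx1 hyx
    have hysub : y - x = x * (Real.exp h - 1) := by rw [hy]; ring
    have hlogy : Real.log y = L + h := by
      rw [hy, Real.log_mul hx0.ne' (Real.exp_pos h).ne', Real.log_exp]
    -- Shiu's hypotheses for the interval `(x, y]`
    have hS1 : x ^ (1 / 4 : ℝ) ≤ y - x := by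
      rw [hysub]
      -- `x^{1/4} = x · x^{-3/4} ≤ x h ≤ x (e^h - 1)`
      have h34 : (c / 2) * u ≤ (3 / 4) * L := by
        rw [← huL]; nlinarith
      have hxh : x ^ (1 / 4 : ℝ) ≤ x * h := by
        have e1 : x ^ (1 / 4 : ℝ) = x * Real.exp (-(3 / 4) * L) := by
          rw [hL, show -(3 / 4) * Real.log x = Real.log x * (-(3 / 4)) by ring,
            ← Real.rpow_def_of_pos hx0, ← Real.rpow_one_add' hx0.le (by norm_num)]
          norm_num
        rw [e1]
        refine mul_le_mul_of_nonneg_left (Real.exp_le_exp.mpr (by linarith)) hx0.le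
      exact hxh.trans (mul_le_mul_of_nonneg_left hexp2 hx0.le)
    have hS2 : y - x ≤ x := by
      rw [hysub]
      have : Real.exp h - 1 ≤ 1 := by linarith
      nlinarith
    have hshiu := hShiu x (y - x) hxx₀ hS1 hS2
    rw [show x + (y - x) = y by ring] at hshiu
    -- identify Shiu's index set with `Icc (⌊x⌋₊+1) ⌊y⌋₊`
    have hset : (Icc 1 ⌊y⌋₊).filter (fun n : ℕ => x < n) = Icc (⌊x⌋₊ + 1) ⌊y⌋₊ := by
      ext n
      simp only [Finset.mem_filter, Finset.mem_Icc]
      constructor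
      · rintro ⟨⟨-, h2⟩, h3⟩
        exact ⟨(Nat.floor_lt hx0.le).mpr h3, h2⟩
      · rintro ⟨h1, h2⟩
        exact ⟨⟨by omega, h2⟩, (Nat.floor_lt hx0.le).mp (by omega)⟩
    rw [hset] at hshiu
    -- the short sum
    have hshort : |∑ n ∈ Icc (⌊x⌋₊ + 1) ⌊y⌋₊, g n * Real.log (y / n)| ≤ h * (C_S * (2 * h)) := by
      calc |∑ n ∈ Icc (⌊x⌋₊ + 1) ⌊y⌋₊, g n * Real.log (y / n)|
          ≤ ∑ n ∈ Icc (⌊x⌋₊ + 1) ⌊y⌋₊, |g n * Real.log (y / n)| := Finset.abs_sum_le_sum_abs _ _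
        _ ≤ ∑ n ∈ Icc (⌊x⌋₊ + 1) ⌊y⌋₊, h * ((μ n : ℝ) ^ 2 * (polyRootCountMod ![f] n : ℝ) / x) := by
            refine Finset.sum_le_sum fun n hn => ?_
            obtain ⟨hn1, hn2⟩ := Finset.mem_Icc.mp hn
            have hxn : x < n := (Nat.floor_lt hx0.le).mp (by omega)
            have hn0 : (0 : ℝ) < n := by linarith
            have hny : (n : ℝ) ≤ y := by
              have := Nat.floor_le (by linarith : (0 : ℝ) ≤ y)
              exact le_trans (by exact_mod_cast hn2) this
            have hlog0 : 0 ≤ Real.log (y / n) := Real.log_nonneg ((one_le_div hn0).mpr hny)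
            have hlogh : Real.log (y / n) ≤ h := by
              rw [Real.log_div (by linarith) hn0.ne', hlogy]
              have := Real.log_lt_log hx0 hxn
              linarith
            rw [abs_mul, abs_of_nonneg hlog0, abs_moebius_mul_rootDensity_eq, mul_comm]
            refine mul_le_mul hlogh ?_ (by positivity) hh0.le
            exact div_le_div_of_nonneg_left (by positivity) hx0 hxn.le
        _ = h * ((∑ n ∈ Icc (⌊x⌋₊ + 1) ⌊y⌋₊, (μ n : ℝ) ^ 2 * (polyRootCountMod ![f] n : ℝ)) / x) := by
            rw [← Finset.mul_sum, Finset.sum_div]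
        _ ≤ h * (C_S * (y - x) / x) := by
            refine mul_le_mul_of_nonneg_left (div_le_div_of_nonneg_right hshiu hx0.le) hh0.le
        _ ≤ h * (C_S * (2 * h)) := by
            refine mul_le_mul_of_nonneg_left ?_ hh0.le
            rw [hysub, div_eq_mul_inv, mul_assoc, mul_assoc, ← mul_assoc x, mul_comm x,
              mul_assoc, mul_inv_cancel₀ hx0.ne', mul_one]
            exact mul_le_mul_of_nonneg_left hexp1 hCS
    -- the two Riesz means
    have hRx := hR x hx1
    have hRy : |∑ n ∈ Icc 1 ⌊y⌋₊, g n * Real.log (y / n) - c₀| ≤ C_R * Real.exp (-c * u) := by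
      refine (hR y hy1).trans (mul_le_mul_of_nonneg_left (Real.exp_le_exp.mpr ?_) hC_R)
      have : u ≤ Real.sqrt (Real.log y) := Real.sqrt_le_sqrt (by rw [hlogy]; linarith)
      nlinarith
    have hid := riesz_sub_riesz_eq g hx1 hyx
    rw [hlogy, show L + h - Real.log x = h by rw [hL]; ring] at hid
    -- combine
    have hkey : h * |∑ n ∈ Icc 1 ⌊x⌋₊, g n| ≤ 2 * C_R * Real.exp (-c * u) + h * (C_S * (2 * h)) := by
      have e1 : h * ∑ n ∈ Icc 1 ⌊x⌋₊, g n =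
          (∑ n ∈ Icc 1 ⌊y⌋₊, g n * Real.log (y / n) - c₀) -
            (∑ n ∈ Icc 1 ⌊x⌋₊, g n * Real.log (x / n) - c₀) -
            ∑ n ∈ Icc (⌊x⌋₊ + 1) ⌊y⌋₊, g n * Real.log (y / n) := by linarith
      have e2 : h * |∑ n ∈ Icc 1 ⌊x⌋₊, g n| =
          |(∑ n ∈ Icc 1 ⌊y⌋₊, g n * Real.log (y / n) - c₀) -
            (∑ n ∈ Icc 1 ⌊x⌋₊, g n * Real.log (x / n) - c₀) -
            ∑ n ∈ Icc (⌊x⌋₊ + 1) ⌊y⌋₊, g n * Real.log (y / n)| := by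
        rw [← e1, abs_mul, abs_of_pos hh0]
      rw [e2]
      refine (abs_sub _ _).trans ?_
      refine (add_le_add (abs_sub _ _) le_rfl).trans ?_
      have hRx' : |∑ n ∈ Icc 1 ⌊x⌋₊, g n * Real.log (x / n) - c₀| ≤ C_R * Real.exp (-c * u) := hRx
      linarith [hRx', hRy, hshort]
    -- divide by `h`: `exp(-c u)/h = exp(-(c/2) u)`
    have hdiv : Real.exp (-c * u) = h * Real.exp (-(c / 2) * u) := by
      rw [hh, ← Real.exp_add]; congr 1; ring
    rw [hdiv] at hkey
    have hfinal : |∑ n ∈ Icc 1 ⌊x⌋₊, g n| ≤ 2 * C_R * Real.exp (-(c / 2) * u) + C_S * (2 * h) := by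
      have := mul_le_mul_of_nonneg_left hkey (inv_pos.mpr hh0).le
      rw [← mul_assoc, inv_mul_cancel₀ hh0.ne', one_mul] at this
      refine this.trans_eq ?_
      field_simp
    calc |∑ n ∈ Icc 1 ⌊x⌋₊, g n| ≤ 2 * C_R * Real.exp (-(c / 2) * u) + C_S * (2 * h) := hfinal
      _ = (2 * C_R + 2 * C_S) * Real.exp (-(c / 2) * Real.sqrt (Real.log x)) := by
          rw [hh, hu, hL]; ring
  -- small `x`: the trivial bound
  set m : ℝ := Real.exp (-(c / 2) * Real.sqrt (Real.log x₁)) with hm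
  have hm0 : 0 < m := Real.exp_pos _
  have hx₁1 : 1 ≤ x₁ := le_trans (by norm_num) (le_trans (le_max_right x₀ 2) (le_max_left _ _))
  refine ⟨c / 2, max (2 * C_R + 2 * C_S) (x₁ / m), half_pos hc, fun x hx => ?_⟩
  have hexp0 : 0 < Real.exp (-(c / 2) * Real.sqrt (Real.log x)) := Real.exp_pos _
  rcases le_or_gt x₁ x with hxl | hxs
  · refine (hlarge x hxl).trans ?_
    rw [show -(c / 2) * Real.sqrt (Real.log x) = -(c / 2) * Real.sqrt (Real.log x) by rfl]
    exact mul_le_mul_of_nonneg_right (le_max_left _ _) hexp0.le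
  · -- `|S(x)| ≤ ⌊x⌋ ≤ x₁ = (x₁/m) m ≤ (x₁/m) exp(-(c/2)√log x)`
    have h1 : |∑ n ∈ Icc 1 ⌊x⌋₊, g n| ≤ x₁ := by
      calc |∑ n ∈ Icc 1 ⌊x⌋₊, g n| ≤ ∑ n ∈ Icc 1 ⌊x⌋₊, |g n| := Finset.abs_sum_le_sum_abs _ _
        _ ≤ ∑ n ∈ Icc 1 ⌊x⌋₊, (1 : ℝ) :=
            Finset.sum_le_sum fun n _ => abs_moebius_mul_rootDensity_le_one f n
        _ = ⌊x⌋₊ := by simp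
        _ ≤ x := Nat.floor_le (by linarith)
        _ ≤ x₁ := hxs.le
    have h2 : m ≤ Real.exp (-(c / 2) * Real.sqrt (Real.log x)) := by
      refine Real.exp_le_exp.mpr ?_
      have : Real.sqrt (Real.log x) ≤ Real.sqrt (Real.log x₁) :=
        Real.sqrt_le_sqrt (Real.log_le_log (by linarith) hxs.le)
      nlinarith
    calc |∑ n ∈ Icc 1 ⌊x⌋₊, g n| ≤ x₁ := h1
      _ = x₁ / m * m := by field_simp
      _ ≤ x₁ / m * Real.exp (-(c / 2) * Real.sqrt (Real.log x)) :=
          mul_le_mul_of_nonneg_left h2 (by positivity)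
      _ ≤ max (2 * C_R + 2 * C_S) (x₁ / m) * Real.exp (-(c / 2) * Real.sqrt (Real.log x)) :=
          mul_le_mul_of_nonneg_right (le_max_right _ _) hexp0.le

end Summit.Parity.BatemanHorn.Theorems.TypeIMainTerm

end
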